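import Literature.NumberTheory.LFunctions.ConreyIwaniec2002BesselAmplitudeDeriv
import HarnessLib

/-!
# Conrey–Iwaniec (2002), §4 (4.22)–(4.23): `∃ C_W > 0, BesselJZeroAmplitude C_W` (stub S3c1)

B. Conrey, H. Iwaniec, *Spacing of zeros of Hecke `L`-functions and the class number problem*,
Acta Arith. 103 (2002) 259–312, §4 [held text `paper:arxiv-math_0111012`, p0012:L40–57]: the
amplitude/phase form `J₀(u) = Re(e^{iu}W(u))` with `|W^{(ν)}(u)| ≤ C_W u^{−1/2−ν}` (`ν ≤ 2`).
Registered stub S3c1 `stub_bessel_amplitude` of SKELETON S3 (cell `landau-siegel/ls-inputs`, line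
`theta-circle-method`; interface `ConreyIwaniec2002.BesselJZeroAmplitude`, Defs file), PROVED here
for ALL `u > 0` with the elementary witness of part 1
(`ConreyIwaniec2002BesselAmplitudeDeriv.lean`):
`W(u) = e^{−iu}(J₀(u) + iJ₁(u) − iρ(u)J₀(u))`, `ρ(u) = u/(2(u²+1))`.

* `bessel_amplitude : ∃ C_W : ℝ, 0 < C_W ∧ BesselJZeroAmplitude C_W` (statement verbatim), with
  `C_W = 100 + 7(|C₀| + |C₁|)`, `C_n` the constants of the tree's
  `abs_besselJ_le_mul_rpow_neg_half n` (`|J_n(u)| ≤ C_n u^{−1/2}` for `u ≥ n + 1`).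
Proof: `ContDiff ℝ 2 W` from `contDiff_besselJ_holds`; `iteratedDerivWithin ν W (Ioi 0)` is `W`,
`W'`, `W''` (`iteratedDerivWithin_of_isOpen`, the explicit `HasDerivAt`s of part 1); for `u ≥ 2`
the brackets are `≤ (9/4)C u^{−1/2}`, `2C u^{−3/2}`, `7C u^{−5/2}`; for `0 < u ≤ 2` they are
`≤ 9/4`, `5/4`, `33/8 + 2u⁻¹` (using `|J₁(u)| ≤ u/2`, tree `abs_besselJ_one_le_half_mul_abs`) while
`u^{−1/2−ν} ≥ 1/8` and `u^{−5/2} ≥ u⁻¹/8` there.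

## References

* [ConreyIwaniec2002] B. Conrey, H. Iwaniec, Acta Arith. 103 (2002) 259–312, arXiv:math/0111012:
  §4 (4.22)–(4.23).
-/

noncomputable section

open Complex Set Real

namespace Literature.NumberTheory.LFunctions

namespace ConreyIwaniec2002

namespace BesselAmplitude

open Literature.Analysis.FunctionSpaces

/-! ### Elementary regime inequalities -/

/-- For `0 < u ≤ 2` and `−3 ≤ e ≤ 0`: `u^e ≥ 1/8`. [cite: ConreyIwaniec2002, §4 (4.22)–(4.23)] -/
theorem one_eighth_le_rpow {u e : ℝ} (hu : 0 < u) (hu2 : u ≤ 2) (he : -3 ≤ e) (he0 : e ≤ 0) :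
    1 / 8 ≤ u ^ e := by
  have h1 : (2 : ℝ) ^ (-3 : ℝ) = 1 / 8 := by
    rw [Real.rpow_neg (by norm_num), show (3 : ℝ) = (3 : ℕ) by norm_num, Real.rpow_natCast]
    norm_num
  calc (1 : ℝ) / 8 = (2 : ℝ) ^ (-3 : ℝ) := h1.symm
    _ ≤ 2 ^ e := Real.rpow_le_rpow_of_exponent_le (by norm_num) he
    _ ≤ u ^ e := Real.rpow_le_rpow_of_nonpos hu hu2 he0

/-- Decay regime (`u ≥ 2`): the `J₀`-coefficient of `W'` is `≤ u⁻¹`. [cite: ConreyIwaniec2002, §4 (4.22)–(4.23)] -/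
theorem decay_coeff₁ {u : ℝ} (hu : 2 ≤ u) :
    |u / (2 * (u ^ 2 + 1))| + 1 / (2 * (u ^ 2 + 1)) ≤ u⁻¹ := by
  have hu0 : 0 < u := by linarith
  have h1 := abs_rho_le_inv hu0
  have h2 : 1 / (2 * (u ^ 2 + 1)) ≤ 1 / (2 * u) :=
    one_div_le_one_div_of_le (by positivity) (by nlinarith)
  have h3 : 1 / (2 * u) + 1 / (2 * u) = u⁻¹ := by field_simp; norm_num
  linarith

/-- Decay regime (`u ≥ 2`): the `J₀`-coefficient of `W''` is `≤ 3u⁻²`. [cite: ConreyIwaniec2002, §4 (4.22)–(4.23)] -/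
theorem decay_coeff₂₀ {u : ℝ} (hu : 2 ≤ u) :
    1 / (u ^ 2 + 1) + 3 * u / (u ^ 2 + 1) ^ 2 + (u * (u ^ 2 + 1))⁻¹ ≤ 3 * u⁻¹ ^ 2 := by
  have hu0 : 0 < u := by linarith
  have h1 : 1 / (u ^ 2 + 1) ≤ u⁻¹ ^ 2 := by
    rw [inv_pow, ← one_div]; exact one_div_le_one_div_of_le (by positivity) (by linarith)
  have h2 : 3 * u / (u ^ 2 + 1) ^ 2 ≤ 3 / 2 * u⁻¹ ^ 2 := by
    rw [inv_pow, show (3 : ℝ) / 2 * (u ^ 2)⁻¹ = (3 / 2) / u ^ 2 by ring,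
      div_le_div_iff₀ (by positivity) (by positivity)]
    nlinarith [sq_nonneg u, sq_nonneg (u ^ 2)]
  have h3 : (u * (u ^ 2 + 1))⁻¹ ≤ 1 / 2 * u⁻¹ ^ 2 := by
    rw [inv_pow, ← div_eq_mul_inv, div_div, ← one_div]
    exact one_div_le_one_div_of_le (by positivity) (by nlinarith)
  linarith

/-- Decay regime (`u ≥ 2`): the `J₁`-coefficient of `W''` is `≤ 4u⁻²`. [cite: ConreyIwaniec2002, §4 (4.22)–(4.23)] -/
theorem decay_coeff₂₁ {u : ℝ} (hu : 2 ≤ u) :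
    (u * (u ^ 2 + 1))⁻¹ + (1 / (u ^ 2 + 1) + 2 * u⁻¹ ^ 2 + |u / (2 * (u ^ 2 + 1))| * u⁻¹) ≤
      4 * u⁻¹ ^ 2 := by
  have hu0 : 0 < u := by linarith
  have h1 : 1 / (u ^ 2 + 1) ≤ u⁻¹ ^ 2 := by
    rw [inv_pow, ← one_div]; exact one_div_le_one_div_of_le (by positivity) (by linarith)
  have h3 : (u * (u ^ 2 + 1))⁻¹ ≤ 1 / 2 * u⁻¹ ^ 2 := by
    rw [inv_pow, ← div_eq_mul_inv, div_div, ← one_div]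
    exact one_div_le_one_div_of_le (by positivity) (by nlinarith)
  have h4 : |u / (2 * (u ^ 2 + 1))| * u⁻¹ ≤ 1 / 2 * u⁻¹ ^ 2 := by
    have := abs_rho_le_inv hu0
    calc |u / (2 * (u ^ 2 + 1))| * u⁻¹ ≤ 1 / (2 * u) * u⁻¹ :=
          mul_le_mul_of_nonneg_right this (inv_nonneg.2 hu0.le)
      _ = 1 / 2 * u⁻¹ ^ 2 := by field_simp
  linarith

/-- Small arguments (`u ≤ 2`): the bracket of `W'` is bounded by `5/4` (uses `|J₁(u)| ≤ u/2`). [cite: ConreyIwaniec2002, §4 (4.22)–(4.23)] -/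
theorem small_coeff₁ {u : ℝ} (hu : 0 < u) (x y : ℝ) (hx : |x| ≤ 1) (hy : |y| ≤ u / 2) :
    (|u / (2 * (u ^ 2 + 1))| + 1 / (2 * (u ^ 2 + 1))) * |x| + u⁻¹ * |y| ≤ 5 / 4 := by
  have h1 := abs_rho_le_quarter u
  have h2 : 1 / (2 * (u ^ 2 + 1)) ≤ 1 / 2 :=
    one_div_le_one_div_of_le (by norm_num) (by nlinarith)
  have h3 : (|u / (2 * (u ^ 2 + 1))| + 1 / (2 * (u ^ 2 + 1))) * |x| ≤ 3 / 4 := by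
    calc (|u / (2 * (u ^ 2 + 1))| + 1 / (2 * (u ^ 2 + 1))) * |x|
        ≤ (|u / (2 * (u ^ 2 + 1))| + 1 / (2 * (u ^ 2 + 1))) * 1 :=
          mul_le_mul_of_nonneg_left hx (by positivity)
      _ ≤ 3 / 4 := by linarith
  have h4 : u⁻¹ * |y| ≤ 1 / 2 :=
    calc u⁻¹ * |y| ≤ u⁻¹ * (u / 2) := mul_le_mul_of_nonneg_left hy (inv_nonneg.2 hu.le)
      _ = 1 / 2 := by field_simp
  linarith

/-- Small arguments (`u ≤ 2`): the bracket of `W''` is `≤ 33/8 + 2u⁻¹` (uses `|J₁(u)| ≤ u/2`). [cite: ConreyIwaniec2002, §4 (4.22)–(4.23)] -/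
theorem small_coeff₂ {u : ℝ} (hu : 0 < u) (hu2 : u ≤ 2) (x y : ℝ) (hx : |x| ≤ 1)
    (hy : |y| ≤ u / 2) :
    (1 / (u ^ 2 + 1) + 3 * u / (u ^ 2 + 1) ^ 2 + (u * (u ^ 2 + 1))⁻¹) * |x| +
        ((u * (u ^ 2 + 1))⁻¹ + (1 / (u ^ 2 + 1) + 2 * u⁻¹ ^ 2 + |u / (2 * (u ^ 2 + 1))| * u⁻¹)) *
          |y| ≤ 33 / 8 + 2 * u⁻¹ := by
  have hρ := abs_rho_le_quarter u
  have h1 : 1 / (u ^ 2 + 1) ≤ 1 := by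
    rw [div_le_one (by positivity)]; nlinarith
  have h2 : 3 * u / (u ^ 2 + 1) ^ 2 ≤ 3 / 2 := by
    rw [div_le_iff₀ (by positivity)]; nlinarith [sq_nonneg (u - 1), sq_nonneg u]
  have h3 : (u * (u ^ 2 + 1))⁻¹ ≤ u⁻¹ := by
    rw [mul_inv]
    calc u⁻¹ * (u ^ 2 + 1)⁻¹ ≤ u⁻¹ * 1 :=
          mul_le_mul_of_nonneg_left (inv_le_one_of_one_le₀ (by nlinarith)) (inv_nonneg.2 hu.le)
      _ = u⁻¹ := mul_one _
  have hA : (1 / (u ^ 2 + 1) + 3 * u / (u ^ 2 + 1) ^ 2 + (u * (u ^ 2 + 1))⁻¹) * |x| ≤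
      5 / 2 + u⁻¹ := by
    calc (1 / (u ^ 2 + 1) + 3 * u / (u ^ 2 + 1) ^ 2 + (u * (u ^ 2 + 1))⁻¹) * |x|
        ≤ (1 / (u ^ 2 + 1) + 3 * u / (u ^ 2 + 1) ^ 2 + (u * (u ^ 2 + 1))⁻¹) * 1 :=
          mul_le_mul_of_nonneg_left hx (by positivity)
      _ ≤ 5 / 2 + u⁻¹ := by linarith
  have hB : ((u * (u ^ 2 + 1))⁻¹ + (1 / (u ^ 2 + 1) + 2 * u⁻¹ ^ 2 +
      |u / (2 * (u ^ 2 + 1))| * u⁻¹)) * |y| ≤ 13 / 8 + u⁻¹ := by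
    have hc : (u * (u ^ 2 + 1))⁻¹ + (1 / (u ^ 2 + 1) + 2 * u⁻¹ ^ 2 +
        |u / (2 * (u ^ 2 + 1))| * u⁻¹) ≤ u⁻¹ + (1 + 2 * u⁻¹ ^ 2 + 1 / 4 * u⁻¹) := by
      have : |u / (2 * (u ^ 2 + 1))| * u⁻¹ ≤ 1 / 4 * u⁻¹ :=
        mul_le_mul_of_nonneg_right hρ (inv_nonneg.2 hu.le)
      linarith
    calc _ ≤ (u⁻¹ + (1 + 2 * u⁻¹ ^ 2 + 1 / 4 * u⁻¹)) * (u / 2) :=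
          mul_le_mul hc hy (abs_nonneg _) (by positivity)
      _ = 1 / 2 + u / 2 + u⁻¹ + 1 / 8 := by field_simp; ring
      _ ≤ 13 / 8 + u⁻¹ := by linarith
  linarith

end BesselAmplitude

open BesselAmplitude Literature.Analysis.FunctionSpaces in
/-- **S3c1 — the amplitude/phase form of `J₀` (MI-1; registered stub `stub_bessel_amplitude` of
SKELETON S3, statement verbatim)**: `∃ C_W > 0, BesselJZeroAmplitude C_W`. Witness
`W(u) = e^{−iu}(J₀(u) + iJ₁(u) − iρ(u)J₀(u))` with `ρ(u) = u/(2(u²+1)) = 1/(2u) + O(u⁻³)`: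
`Re(e^{iu}W) = J₀` identically; `W' = e^{−iu}[−(ρ+iρ')J₀ + i(ρ−u⁻¹)J₁]`,
`W'' = e^{−iu}[(i(2ρ−u⁻¹) − 2ρ' − iρ'')J₀ + ((2ρ−u⁻¹) + i(2ρ'+2u⁻²−ρu⁻¹))J₁]` (from `J₀' = −J₁`,
`(uJ₁)' = uJ₀` only), whose coefficients are `O(u⁻¹)`, `O(u⁻²)`; with `|J₀|, |J₁| ≤ Cu^{−1/2}`
for `u ≥ 2` and `|J₀| ≤ 1`, `|J₁| ≤ u/2` for `u ≤ 2` this gives `|W^{(ν)}(u)| ≤ C_W u^{−1/2−ν}`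
for `ν ≤ 2` and ALL `u > 0` (print: "`J₀(2πy) = W(y)e(y) + W̄(y)e(−y)` where `W(y)` is a smooth
non-oscillatory function whose derivatives satisfy `y^νW^{(ν)}(y) ≪ y^{−1/2}`").
[cite: ConreyIwaniec2002, §4 (4.22)–(4.23)] -/
theorem bessel_amplitude : ∃ C_W : ℝ, 0 < C_W ∧ BesselJZeroAmplitude C_W := by
  obtain ⟨C₀, hC₀⟩ := abs_besselJ_le_mul_rpow_neg_half 0
  obtain ⟨C₁, hC₁⟩ := abs_besselJ_le_mul_rpow_neg_half 1
  set Cm : ℝ := |C₀| + |C₁| with hCm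
  have hCm0 : 0 ≤ Cm := by positivity
  have hJ0d : ∀ x : ℝ, 2 ≤ x → |besselJ 0 x| ≤ Cm * x ^ (-(1 / 2 : ℝ)) := fun x hx ↦ by
    have h := hC₀ x (by norm_num; linarith)
    refine h.trans (mul_le_mul_of_nonneg_right ?_ (by positivity))
    exact (le_abs_self C₀).trans (by rw [hCm]; linarith [abs_nonneg C₁])
  have hJ1d : ∀ x : ℝ, 2 ≤ x → |besselJ 1 x| ≤ Cm * x ^ (-(1 / 2 : ℝ)) := fun x hx ↦ by
    have h := hC₁ x (by norm_num; linarith)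
    refine h.trans (mul_le_mul_of_nonneg_right ?_ (by positivity))
    exact (le_abs_self C₁).trans (by rw [hCm]; linarith [abs_nonneg C₀])
  have hJ0one : ∀ x : ℝ, |besselJ 0 x| ≤ 1 := abs_besselJ_zero_le_one_holds
  have hJ1half : ∀ x : ℝ, 0 < x → |besselJ 1 x| ≤ x / 2 := fun x hx ↦ by
    have := abs_besselJ_one_le_half_mul_abs x; rwa [abs_of_pos hx] at this
  refine ⟨100 + 7 * Cm, by positivity, ?_⟩
  -- the witness
  set W : ℝ → ℂ := fun v : ℝ ↦ exp (-I * v) * ((besselJ 0 v : ℂ) + I * (besselJ 1 v : ℂ) -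
    I * ((v / (2 * (v ^ 2 + 1)) : ℝ) : ℂ) * (besselJ 0 v : ℂ)) with hW
  set W₁ : ℝ → ℂ := fun u : ℝ ↦ exp (-I * u) * (-(((u / (2 * (u ^ 2 + 1)) : ℝ) : ℂ) + I * (((1 - u ^ 2) / (2 * (u ^ 2 + 1) ^ 2) : ℝ) : ℂ)) * (besselJ 0 u : ℂ) +
    I * (((u / (2 * (u ^ 2 + 1)) : ℝ) : ℂ) - ((u⁻¹ : ℝ) : ℂ)) * (besselJ 1 u : ℂ)) with hW₁
  set W₂ : ℝ → ℂ := fun u : ℝ ↦ exp (-I * u) * ((-2 * (((1 - u ^ 2) / (2 * (u ^ 2 + 1) ^ 2) : ℝ) : ℂ) - I * ((u * (u ^ 2 - 3) / (u ^ 2 + 1) ^ 3 : ℝ) : ℂ) + I * (2 * ((u / (2 * (u ^ 2 + 1)) : ℝ) : ℂ) - ((u⁻¹ : ℝ) : ℂ))) *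
      (besselJ 0 u : ℂ) +
    ((2 * ((u / (2 * (u ^ 2 + 1)) : ℝ) : ℂ) - ((u⁻¹ : ℝ) : ℂ)) + I * (2 * (((1 - u ^ 2) / (2 * (u ^ 2 + 1) ^ 2) : ℝ) : ℂ) + 2 * ((u⁻¹ : ℝ) : ℂ) ^ 2 - ((u / (2 * (u ^ 2 + 1)) : ℝ) : ℂ) * ((u⁻¹ : ℝ) : ℂ))) * (besselJ 1 u : ℂ)) with hW₂
  have hd₁ : ∀ u : ℝ, u ≠ 0 → HasDerivAt W (W₁ u) u := fun u hu ↦ hasDerivAt_amplitude hu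
  have hd₂ : ∀ u : ℝ, u ≠ 0 → HasDerivAt W₁ (W₂ u) u := fun u hu ↦ hasDerivAt_amplitude_deriv hu
  -- smoothness
  have hWcd : ContDiff ℝ 2 W := by
    have hlin : ContDiff ℝ 2 (fun v : ℝ ↦ -I * (v : ℂ)) :=
      contDiff_const.mul Complex.ofRealCLM.contDiff
    have hexp : ContDiff ℝ 2 (fun v : ℝ ↦ exp (-I * v)) := hlin.cexp
    have hJ0 : ContDiff ℝ 2 (fun v : ℝ ↦ (besselJ 0 v : ℂ)) :=
      Complex.ofRealCLM.contDiff.comp (contDiff_besselJ_holds 0)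
    have hJ1 : ContDiff ℝ 2 (fun v : ℝ ↦ (besselJ 1 v : ℂ)) :=
      Complex.ofRealCLM.contDiff.comp (contDiff_besselJ_holds 1)
    have hρr : ContDiff ℝ 2 (fun v : ℝ ↦ v / (2 * (v ^ 2 + 1))) :=
      contDiff_id.div (contDiff_const.mul ((contDiff_id.pow 2).add contDiff_const))
        (fun v ↦ by positivity)
    have hρ : ContDiff ℝ 2 (fun v : ℝ ↦ ((v / (2 * (v ^ 2 + 1)) : ℝ) : ℂ)) :=
      Complex.ofRealCLM.contDiff.comp hρr
    exact hexp.mul ((hJ0.add (contDiff_const.mul hJ1)).sub ((contDiff_const.mul hρ).mul hJ0))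
  refine ⟨W, hWcd.contDiffOn, fun u _ ↦ ?_, ?_⟩
  · -- `J₀ = Re(e^{iu} W)`
    simp only [hW]
    rw [← mul_assoc, ← Complex.exp_add, show I * (u : ℂ) + -I * u = 0 by ring, Complex.exp_zero,
      one_mul]
    simp only [Complex.add_re, Complex.sub_re, Complex.mul_re, Complex.mul_im, Complex.I_re,
      Complex.I_im, Complex.ofReal_re, Complex.ofReal_im]
    ring
  -- the symbol bounds
  intro ν hν u hu
  rw [iteratedDerivWithin_of_isOpen isOpen_Ioi hu]
  have hu0 : u ≠ 0 := hu.ne'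
  have hsm : ∀ e : ℝ, -3 ≤ e → e ≤ 0 → u ≤ 2 → 1 / 8 ≤ u ^ e := fun e he he0 hu2 ↦
    one_eighth_le_rpow hu hu2 he he0
  interval_cases ν
  · -- ν = 0
    rw [iteratedDeriv_zero, Nat.cast_zero, sub_zero]
    simp only [hW]
    rw [norm_mul, norm_exp_neg_I_mul, one_mul]
    refine (norm_bracket₀_le u).trans ?_
    rcases le_total u 2 with h2 | h2
    · have := hsm (-(1 / 2)) (by norm_num) (by norm_num) h2
      have h9 : |besselJ 0 u| + |besselJ 1 u| + 1 / 4 * |besselJ 0 u| ≤ 9 / 4 := by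
        linarith [hJ0one u, abs_besselJ_one_le_one u]
      nlinarith
    · have a := hJ0d u h2
      have b := hJ1d u h2
      have hs : 0 ≤ u ^ (-(1 / 2 : ℝ)) := by positivity
      nlinarith
  · -- ν = 1
    rw [iteratedDeriv_one, (hd₁ u hu0).deriv, Nat.cast_one]
    simp only [hW₁]
    rw [norm_mul, norm_exp_neg_I_mul, one_mul]
    refine (norm_bracket₁_le hu).trans ?_
    rcases le_total u 2 with h2 | h2
    · have := hsm (-(1 / 2) - 1) (by norm_num) (by norm_num) h2
      have h5 := small_coeff₁ hu (besselJ 0 u) (besselJ 1 u) (hJ0one u) (hJ1half u hu)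
      nlinarith
    · have a := hJ0d u h2
      have b := hJ1d u h2
      have hc := decay_coeff₁ h2
      have hs : 0 ≤ u ^ (-(1 / 2 : ℝ)) := by positivity
      have hi : 0 ≤ u⁻¹ := inv_nonneg.2 hu.le
      rw [Real.rpow_sub_one hu0]
      have h1 : (|u / (2 * (u ^ 2 + 1))| + 1 / (2 * (u ^ 2 + 1))) * |besselJ 0 u| ≤
          u⁻¹ * (Cm * u ^ (-(1 / 2 : ℝ))) :=
        mul_le_mul hc a (abs_nonneg _) hi
      have h3 : u⁻¹ * |besselJ 1 u| ≤ u⁻¹ * (Cm * u ^ (-(1 / 2 : ℝ))) :=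
        mul_le_mul_of_nonneg_left b hi
      set s : ℝ := u ^ (-(1 / 2 : ℝ)) with hs_def
      have h4 : u⁻¹ * (Cm * s) + u⁻¹ * (Cm * s) ≤ (100 + 7 * Cm) * (s / u) := by
        rw [div_eq_mul_inv]
        nlinarith [mul_nonneg hs hi, hCm0]
      linarith
  · -- ν = 2
    rw [iteratedDeriv_succ, iteratedDeriv_one]
    have hev : deriv W =ᶠ[nhds u] W₁ :=
      Filter.eventuallyEq_of_mem (isOpen_ne.mem_nhds hu0) fun v hv ↦ (hd₁ v hv).deriv
    rw [hev.deriv_eq, (hd₂ u hu0).deriv, Nat.cast_ofNat]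
    simp only [hW₂]
    rw [norm_mul, norm_exp_neg_I_mul, one_mul]
    refine (norm_bracket₂_le hu).trans ?_
    rcases le_total u 2 with h2 | h2
    · have e1 : u ^ (-(1 / 2 : ℝ) - 2) = u ^ (-(3 / 2 : ℝ)) * u⁻¹ := by
        rw [show (-(1 / 2 : ℝ) - 2) = -(3 / 2 : ℝ) + (-1) by norm_num, Real.rpow_add hu,
          Real.rpow_neg_one]
      have t1 := hsm (-(1 / 2) - 2) (by norm_num) (by norm_num) h2
      have t2 := hsm (-(3 / 2)) (by norm_num) (by norm_num) h2
      have h5 := small_coeff₂ hu h2 (besselJ 0 u) (besselJ 1 u) (hJ0one u) (hJ1half u hu)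
      have hi : 0 ≤ u⁻¹ := inv_nonneg.2 hu.le
      have t3 : 1 / 8 * u⁻¹ ≤ u ^ (-(1 / 2 : ℝ) - 2) := by
        rw [e1]; exact mul_le_mul_of_nonneg_right t2 hi
      nlinarith
    · have a := hJ0d u h2
      have b := hJ1d u h2
      have hc0 := decay_coeff₂₀ h2
      have hc1 := decay_coeff₂₁ h2
      have hs : 0 ≤ u ^ (-(1 / 2 : ℝ)) := by positivity
      have hi : 0 ≤ u⁻¹ ^ 2 := by positivity
      rw [Real.rpow_sub hu, Real.rpow_two]
      have h1 : (1 / (u ^ 2 + 1) + 3 * u / (u ^ 2 + 1) ^ 2 + (u * (u ^ 2 + 1))⁻¹) * |besselJ 0 u| ≤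
          3 * u⁻¹ ^ 2 * (Cm * u ^ (-(1 / 2 : ℝ))) :=
        mul_le_mul hc0 a (abs_nonneg _) (by positivity)
      have h3 : ((u * (u ^ 2 + 1))⁻¹ + (1 / (u ^ 2 + 1) + 2 * u⁻¹ ^ 2 +
          |u / (2 * (u ^ 2 + 1))| * u⁻¹)) * |besselJ 1 u| ≤
          4 * u⁻¹ ^ 2 * (Cm * u ^ (-(1 / 2 : ℝ))) :=
        mul_le_mul hc1 b (abs_nonneg _) (by positivity)
      set s : ℝ := u ^ (-(1 / 2 : ℝ)) with hs_def
      have h4 : 3 * u⁻¹ ^ 2 * (Cm * s) + 4 * u⁻¹ ^ 2 * (Cm * s) ≤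
          (100 + 7 * Cm) * (s / u ^ 2) := by
        rw [div_eq_mul_inv, ← inv_pow]
        nlinarith [mul_nonneg hs hi, hCm0]
      linarith

end ConreyIwaniec2002


end Literature.NumberTheory.LFunctions

end
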